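import Literature.Analysis.FunctionSpaces.TorusSobolevSpaceProofs
import Summits.AnomalousDissipation.AnomalousDissipation.Theorems.PumpedMirrorNoSmoothMirrorDodgerTG

/-! # SteadyMirrorGate — T3 rung of `N` (`NoMirrorDodgerTG`, stmt-AnomalousDissipation-33832) on the smooth solenoidal class,
under a `Theorems/SteadyMirrorGate*` module name.

The route's kernel tribunal imports only the landed `Theorems/SteadyMirrorGate*` modules, so the rung proved in
`Theorems/PumpedMirrorNoSmoothMirrorDodgerTG.lean` (census g20 p829921; crit-1 g12 ruling STATUS l.2141 (2): admissible as the
SMG `--witness`) is not visible to it. This file states the rung in its natural STRONGER form — the redundant hypothesis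
`v ∈ V` of the crux is dropped (`𝒱 ⊆ V`, `Torus.smoothSolenoidal_subset_energySpaceV_holds`) — and proves it from the landed
theorem by name. -/

namespace Summit.AnomalousDissipation.AnomalousDissipation.Theorems.SteadyMirrorGate

/-- **Rung of `SteadyMirrorGate.NoMirrorDodgerTG` (stmt-AnomalousDissipation-33832) on `𝒱`**: at the Taylor–Green force no
`v ∈ H` whose `L²` class lies in the smooth solenoidal class `𝒱` and which is `K`-odd almost everywhere is a steady `H`-weak
Euler state. Compared with the crux: the class hypothesis `v ∈ 𝒱` is ADDED and the (then redundant, `𝒱 ⊆ V`) hypothesis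
`v ∈ V` is DROPPED. Proof: `PumpedMirrorNoSmoothMirrorDodgerTG.noMirrorDodgerTG_smoothSolenoidal` +
`Torus.smoothSolenoidal_subset_energySpaceV_holds`. [folklore] -/
theorem noMirrorDodgerTG_rung_smoothSolenoidal :
    ∀ f : UnitAddTorus (Fin 3) → EuclideanSpace ℝ (Fin 3), f = (fun x => !₂[(fourier 1 (x 0) : ℂ).im *
      (fourier 1 (x 1) : ℂ).re * (fourier 1 (x 2) : ℂ).re, -((fourier 1 (x 0) : ℂ).re * (fourier 1 (x 1) : ℂ).im *
      (fourier 1 (x 2) : ℂ).re), (0 : ℝ)]) →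
    ∀ v : ↥(Literature.Analysis.FunctionSpaces.Torus.energySpace (Fin 3)),
      (v : MeasureTheory.Lp (EuclideanSpace ℝ (Fin 3)) 2
        (MeasureTheory.volume : MeasureTheory.Measure (UnitAddTorus (Fin 3)))) ∈
          Literature.Analysis.FunctionSpaces.Torus.smoothSolenoidal (Fin 3) →
      (∀ i j : Fin 3, (fun x => ((v : MeasureTheory.Lp (EuclideanSpace ℝ (Fin 3)) 2
          (MeasureTheory.volume : MeasureTheory.Measure (UnitAddTorus (Fin 3)))) :
            UnitAddTorus (Fin 3) → EuclideanSpace ℝ (Fin 3)) (Function.update x i (-x i)) j) =ᵐ[MeasureTheory.volume]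
        (fun x => if j = i then -(((v : MeasureTheory.Lp (EuclideanSpace ℝ (Fin 3)) 2
          (MeasureTheory.volume : MeasureTheory.Measure (UnitAddTorus (Fin 3)))) :
            UnitAddTorus (Fin 3) → EuclideanSpace ℝ (Fin 3)) x j)
          else ((v : MeasureTheory.Lp (EuclideanSpace ℝ (Fin 3)) 2
            (MeasureTheory.volume : MeasureTheory.Measure (UnitAddTorus (Fin 3)))) :
              UnitAddTorus (Fin 3) → EuclideanSpace ℝ (Fin 3)) x j)) →
      ¬ Literature.Analysis.FluidPDE.Torus.IsSteadyWeakSolution 0 f v := by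
  intro f hf v hsm hK
  exact Summit.AnomalousDissipation.AnomalousDissipation.Theorems.PumpedMirrorNoSmoothMirrorDodgerTG.noMirrorDodgerTG_smoothSolenoidal
    f hf v hsm (Literature.Analysis.FunctionSpaces.Torus.smoothSolenoidal_subset_energySpaceV_holds hsm) hK

end Summit.AnomalousDissipation.AnomalousDissipation.Theorems.SteadyMirrorGate
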